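import Mathlib.MeasureTheory.Measure.GiryMonad
import Mathlib.Probability.Kernel.Proper
import Mathlib.MeasureTheory.Constructions.Cylinders
import Mathlib.MeasureTheory.MeasurableSpace.Embedding
import Mathlib.MeasureTheory.Function.ConditionalExpectation.Basic
import Mathlib.MeasureTheory.Constructions.Pi
import Mathlib.MeasureTheory.Measure.Tilted
import Mathlib.Analysis.Convex.Extreme
import Mathlib.Logic.Function.DependsOn
import Literature.Probability.LatticeModels.LatticeGraph
import Literature.Probability.LatticeModels.Correlations
import Literature.Probability.LatticeModels.IsingModel
import HarnessLib

-- provenance: harness21/H21/H21/Prelude/StatMech/GibbsSpecification.lean @ bc6e1d0 (interim HEAD d8f2665); M5 mechanical rewrite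
/-!
# Gibbsian specifications and DLR Gibbs measures

Trunk G02 (T-STATMECH), prelude item P17 `GibbsSpecification` (notion `gibbs_measure_dlr`).

A *specification* in the sense of Georgii is a family `γ = (γ_Λ)_{Λ ⋐ V}` of proper probability
kernels from the outside σ-algebra `𝓕_{Λᶜ}` to the full product σ-algebra on `Ω = V → S`,
consistent under refinement (`γ_{Λ'} γ_Λ = γ_{Λ'}` for `Λ ⊆ Λ'`). A probability measure `μ` is a
*Gibbs measure* for `γ` if it satisfies the DLR equations `μ γ_Λ = μ` for all finite `Λ`
(Dobrushin 1968; Lanford–Ruelle 1969; Georgii 2011, Def. 1.23 and Def. 2.9).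

## Design (outline D3, option (ii))

* `Specification V S := Finset V → (V → S) → Measure (V → S)` is a type of *plain functions*;
  the axioms are the `Prop`-valued structure `IsSpecification γ`. Reason: concrete
  specifications (`isingSpecification`, `gibbsSpecOfPotential`) must be honest definitions,
  while the measurability in the boundary condition is a genuine theorem
  (`isSpecification_isingSpecification`, proof deferred).
* The DLR equation and the consistency axiom are written **junk-free** with lower Lebesgue
  integrals, `∫⁻ η, γ Λ η A ∂μ = μ A`, rather than with `Measure.bind` (which is `join ∘ map` and
  hence `0` for a non-AE-measurable kernel). The bridge `isGibbsMeasure_iff_bind` recovers the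
  monadic form under `IsSpecification γ`.
* Bridges to Mathlib's kernel library: `IsSpecification.toKernel hγ Λ :
  Kernel[cylinderEvents (↑Λ)ᶜ] (V → S) (V → S)` (a real definition via
  `Measure.measurable_of_measurable_coe`), `IsSpecification.isProper_toKernel`
  (Mathlib `Kernel.IsProper`), `isGibbsMeasure_iff_bind` (the monadic form `μ.bind (γ Λ) = μ`;
  cf. Mathlib `Kernel.Invariant`, which is stated for kernels with equal source and target
  σ-algebras and hence does not apply verbatim to `Kernel[𝓕_{Λᶜ}, 𝓕]`),
  `isGibbsMeasure_iff_condExp` (Georgii's conditional-expectation form).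
* Extremal Gibbs measures use Mathlib `Set.extremePoints ℝ≥0∞`; translations on
  `Site d = Fin d → ℤ` are the measurable equivalences
  `configShift v := MeasurableEquiv.arrowCongr' (Site.shift v) (MeasurableEquiv.refl S)`
  (so `configShift v σ = σ ∘ (Site.shift v).symm`, the same translation as `LatticeGraph`), and
  `IsTranslationInvariantMeasure` (`μ.map (configShift v) = μ`) carries no map-junk.
* Potentials (Georgii Def. 2.7): `Potential.IsAdapted` asks `Φ_A` to depend only on the spins in
  `A` (Mathlib `DependsOn`) **and** to be measurable; for discrete `S` (e.g. `ℤˣ`) with `V`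
  countable the measurability conjunct is automatic. Only *finite-range-type* Hamiltonians are
  formed: `hamiltonianIn Φ supp Λ` sums `Φ_A` over a volume-dependent finite family `supp Λ` of
  interaction sets meeting `Λ` (Georgii (2.11)); absolutely summable infinite-range potentials
  (Georgii Def. 2.7 (ii) in full) are out of scope in v0.
* Finite-volume Gibbs distributions of a potential are built with Mathlib `Measure.tilted`
  (outline D3'); `Measure.tilted` is `0` when the normaliser vanishes or diverges — this junk
  value is Mathlib's and is documented on `gibbsSpecOfPotential`;
  `isProbabilityMeasure_gibbsSpecOfPotential` records when it is not hit.

## Mathlib status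

Mathlib (pinned) has no specifications / DLR Gibbs measures. Anchors used verbatim:
`ProbabilityTheory.Kernel`, `Kernel.IsProper`, `MeasureTheory.cylinderEvents`,
`Measure.measurable_of_measurable_coe`, `Measure.bind`, `MeasureTheory.condExp`,
`Set.extremePoints`, `Measure.pi`, `Measure.tilted`, `DependsOn`, `MeasurableEquiv.arrowCongr'`,
`Function.updateFinset` / `measurable_updateFinset` (`glueWith` is `updateFinset` up to argument
order and decidability, `glueWith_eq_updateFinset`).

## Countability of the site set

Georgii works throughout with a countable site set. The a.e. properness axiom
`IsSpecification.proper` is unsatisfiable for uncountable `V` (with `|S| ≥ 2`), because a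
measurable subset of `V → S` depends on countably many coordinates
(Mathlib `MeasurableSet.eq_preimage_restrict_countable`). Hence the existence theorem
`isSpecification_isingSpecification` assumes `[Countable V]`; the bridge theorems, which take
`IsSpecification γ` as a hypothesis, are stated for arbitrary `V` (vacuous but true otherwise).

## References

* H.-O. Georgii, *Gibbs Measures and Phase Transitions*, 2nd ed. (de Gruyter 2011), Ch. 1
  (specifications, Def. 1.23; DLR, Def. 1.23/Rem. 1.24), Ch. 2 (Gibbsian specifications of a
  potential, Def. 2.9), Ch. 5 (translation invariance), Ch. 7 (extremal Gibbs measures,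
  Thm. 7.7, Cor. 7.4).
* S. Friedli, Y. Velenik, *Statistical Mechanics of Lattice Systems* (CUP 2017), Ch. 6
  (Def. 6.9 specification, Def. 6.13 Gibbs measure, §6.8 extremal decomposition).
-/

noncomputable section

open MeasureTheory ProbabilityTheory Finset
open scoped ENNReal ProbabilityTheory

namespace Literature.Probability.LatticeModels

variable {V S : Type*} [MeasurableSpace S]

/-! ### Specifications -/

/-- A (candidate) specification on the configuration space `V → S`: for every finite volume
`Λ` and every boundary condition `η : V → S`, a measure `γ Λ η` on `V → S`. The axioms
(probability, `𝓕_{Λᶜ}`-measurability, properness, consistency) are the predicate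
`IsSpecification` (Georgii 2011, Def. 1.23; Friedli–Velenik 2017, Def. 6.9). [cite: Georgii2011, Def. 1.23] -/
abbrev Specification (V S : Type*) [MeasurableSpace S] : Type _ :=
  Finset V → (V → S) → Measure (V → S)

/-- `γ` is a specification in the sense of Georgii: each `γ Λ η` is a probability measure,
`η ↦ γ Λ η A` is measurable for the outside σ-algebra `cylinderEvents (↑Λ)ᶜ`, `γ Λ η` is
concentrated on configurations equal to `η` off `Λ` (properness), and the family is consistent,
`∫ γ Λ σ A d(γ Λ' η)(σ) = γ Λ' η A` for `Λ ⊆ Λ'` (Georgii 2011, Def. 1.23 and eq. (1.21);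
Friedli–Velenik 2017, Def. 6.9). [cite: Georgii2011, Def. 1.23 and eq. (1.21] -/
structure IsSpecification (γ : Specification V S) : Prop where
  /-- Each `γ Λ η` is a probability measure (Georgii 2011, Def. 1.23 (i)). -/
  isProbability : ∀ Λ η, IsProbabilityMeasure (γ Λ η)
  /-- `η ↦ γ Λ η A` is `𝓕_{Λᶜ}`-measurable (Georgii 2011, Def. 1.23 (ii)). -/
  measurable : ∀ (Λ : Finset V) (A : Set (V → S)), MeasurableSet A →
    Measurable[cylinderEvents ((↑Λ : Set V)ᶜ)] fun η => γ Λ η A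
  /-- Properness: `γ Λ η`-a.e. configuration agrees with `η` outside `Λ`
  (Georgii 2011, Def. 1.23 (ii), properness). This almost-everywhere form implies Georgii's
  `γ_Λ(A ∩ B | η) = γ_Λ(A | η) 1_B(η)` for `B ∈ 𝓕_{Λᶜ}` (Mathlib `Kernel.IsProper`, see
  `isProper_toKernel`) and agrees with it in Georgii's standing setting of a **countable** site
  set `V` (and `S` with measurable singletons), for which this notion is intended and which the
  outline prescribes. WARNING: for uncountable `V` (and `|S| ≥ 2`) the exceptional set
  `{σ | ∃ x ∉ Λ, σ x ≠ η x}` has outer measure `1` for every probability measure (a measurable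
  set depends on countably many coordinates), so no `γ` is proper in this sense and
  `IsSpecification γ` is unsatisfiable; theorems assuming `IsSpecification γ` are then
  vacuous (but true). -/
  proper : ∀ Λ η, ∀ᵐ σ ∂γ Λ η, ∀ x ∉ Λ, σ x = η x
  /-- Consistency `γ_{Λ'} γ_Λ = γ_{Λ'}` for `Λ ⊆ Λ'` (Georgii 2011, Def. 1.23 (iii)). -/
  consistent : ∀ ⦃Λ Λ' : Finset V⦄, Λ ⊆ Λ' → ∀ (η : V → S) (A : Set (V → S)),
    MeasurableSet A → ∫⁻ σ, γ Λ σ A ∂(γ Λ' η) = γ Λ' η A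

/-! ### DLR Gibbs measures -/

/-- `μ` is a Gibbs measure for `γ` (DLR equations, junk-free form): `μ` is a probability measure
and `∫ γ Λ η A dμ(η) = μ A` for every finite `Λ` and measurable `A`
(Georgii 2011, Def. 1.23 / Rem. 1.24; Friedli–Velenik 2017, Def. 6.13). [cite: Georgii2011, Def. 1.23 / Rem. 1.24] -/
def IsGibbsMeasure (γ : Specification V S) (μ : Measure (V → S)) : Prop :=
  IsProbabilityMeasure μ ∧
    ∀ (Λ : Finset V) (A : Set (V → S)), MeasurableSet A → ∫⁻ η, γ Λ η A ∂μ = μ A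

/-- The set `𝒢(γ)` of Gibbs measures of the specification `γ` (Georgii 2011, Def. 1.23). [cite: Georgii2011, Def. 1.23] -/
def gibbsMeasures (γ : Specification V S) : Set (Measure (V → S)) :=
  {μ | IsGibbsMeasure γ μ}

/-- Membership in `𝒢(γ)` is the DLR condition (Georgii 2011, Def. 1.23). [cite: Georgii2011, Def. 1.23] -/
@[simp] theorem mem_gibbsMeasures_iff (γ : Specification V S) (μ : Measure (V → S)) :
    μ ∈ gibbsMeasures γ ↔ IsGibbsMeasure γ μ := Iff.rfl

/-- A Gibbs measure has total mass one (Georgii 2011, Def. 1.23). [cite: Georgii2011, Def. 1.23] -/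
theorem IsGibbsMeasure.isProbabilityMeasure {γ : Specification V S} {μ : Measure (V → S)}
    (h : IsGibbsMeasure γ μ) : IsProbabilityMeasure μ := h.1

/-- `μ` is an extremal Gibbs measure (a pure phase): an extreme point of the convex set `𝒢(γ)`
(Georgii 2011, Ch. 7, Thm. 7.7; Friedli–Velenik 2017, §6.8). [cite: Georgii2011, Ch. 7  Thm. 7.7] -/
def IsExtremalGibbs (γ : Specification V S) (μ : Measure (V → S)) : Prop :=
  μ ∈ Set.extremePoints ℝ≥0∞ (gibbsMeasures γ)

/-- The specification `γ` admits exactly one Gibbs measure, `|𝒢(γ)| = 1` (uniqueness regime)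
(Georgii 2011, Ch. 8; Friedli–Velenik 2017, §6.5). [cite: Georgii2011, Ch. 8] -/
def HasUniqueGibbsMeasure (γ : Specification V S) : Prop :=
  (gibbsMeasures γ).Subsingleton ∧ (gibbsMeasures γ).Nonempty

/-- `𝒢(γ)` is convex (Georgii 2011, Ch. 7, (7.1); Friedli–Velenik 2017, §6.8). [cite: Georgii2011, Ch. 7  (7.1] -/
def convex_gibbsMeasures : Prop :=
  ∀ (γ : Specification V S),
    Convex ℝ≥0∞ (gibbsMeasures γ)

/-! ### Bridge to Mathlib kernels -/

namespace IsSpecification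

variable {γ : Specification V S}

/-- The `Λ`-kernel of a specification as a Mathlib kernel from the outside σ-algebra
`cylinderEvents (↑Λ)ᶜ` to the product σ-algebra (Georgii 2011, Def. 1.23; Mathlib
`ProbabilityTheory.Kernel`). [cite: Georgii2011, Def. 1.23] -/
def toKernel (hγ : IsSpecification γ) (Λ : Finset V) :
    Kernel[cylinderEvents ((↑Λ : Set V)ᶜ)] (V → S) (V → S) :=
  @Kernel.mk (V → S) (V → S) (cylinderEvents ((↑Λ : Set V)ᶜ)) MeasurableSpace.pi (γ Λ)
    (Measure.measurable_of_measurable_coe (mβ := cylinderEvents ((↑Λ : Set V)ᶜ)) _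
      (hγ.measurable Λ))

/-- The underlying function of `hγ.toKernel Λ` is `γ Λ` (Georgii 2011, Def. 1.23). [cite: Georgii2011, Def. 1.23] -/
@[simp] theorem toKernel_apply (hγ : IsSpecification γ) (Λ : Finset V) (η : V → S) :
    hγ.toKernel Λ η = γ Λ η := rfl

/-- The kernels of a specification are proper in Mathlib's sense (`Kernel.IsProper`)
(Georgii 2011, Def. 1.23 (ii) and Rem. 1.20). [cite: Georgii2011, Def. 1.23 (ii] -/
def isProper_toKernel : Prop :=
  ∀ (hγ : IsSpecification γ) (Λ : Finset V),
    (hγ.toKernel Λ).IsProper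

/-- The kernels of a specification are Markov kernels (Georgii 2011, Def. 1.23 (i)). [cite: Georgii2011, Def. 1.23 (i] -/
theorem isMarkovKernel_toKernel (hγ : IsSpecification γ) (Λ : Finset V) :
    IsMarkovKernel (hγ.toKernel Λ) :=
  ⟨fun η => hγ.isProbability Λ η⟩

end IsSpecification

/-- For a genuine specification the junk-free DLR condition is the monadic one,
`μ.bind (γ Λ) = μ` for all `Λ` (cf. Mathlib `Kernel.Invariant`)
(Georgii 2011, Def. 1.23 / Rem. 1.24). [cite: Georgii2011, Def. 1.23 / Rem. 1.24] -/
def isGibbsMeasure_iff_bind : Prop :=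
  ∀ {γ : Specification V S} (hγ : IsSpecification γ) (μ : Measure (V → S)),
    IsGibbsMeasure γ μ ↔ IsProbabilityMeasure μ ∧ ∀ Λ : Finset V, μ.bind (γ Λ) = μ

/-- Georgii's form of the DLR equations: `μ ∈ 𝒢(γ)` iff `μ` is a probability measure and for
every finite `Λ` and every bounded measurable `f`, `μ[f | 𝓕_{Λᶜ}] = γ_Λ f` `μ`-a.s.
(Georgii 2011, Rem. 1.24 and Thm. 1.33; Friedli–Velenik 2017, Lemma 6.16). [cite: Georgii2011, Rem. 1.24 and Thm. 1.33] -/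
def isGibbsMeasure_iff_condExp : Prop :=
  ∀ {γ : Specification V S} (hγ : IsSpecification γ) (μ : Measure (V → S)),
    IsGibbsMeasure γ μ ↔ IsProbabilityMeasure μ ∧
      ∀ (Λ : Finset V) (f : (V → S) → ℝ), Measurable f → (∃ C, ∀ σ, |f σ| ≤ C) →
        μ[f | cylinderEvents ((↑Λ : Set V)ᶜ)] =ᵐ[μ] fun η => ∫ σ, f σ ∂γ Λ η

/-! ### Translations on `ℤ^d` -/

section Shift

variable {d : ℕ}

/-- Translation of configurations on `ℤ^d` by `v`: `(configShift v σ) x = σ (x - v)`, as a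
measurable equivalence of `Site d → S`. This is Mathlib's `MeasurableEquiv.arrowCongr'` applied to
the lattice translation `Site.shift v : Site d ≃ Site d` of `LatticeGraph`, so the two translation
notions of the trunk agree by definition (Georgii 2011, Ch. 5, (5.3)). [cite: Georgii2011, Ch. 5  (5.3] -/
def configShift (v : Site d) : (Site d → S) ≃ᵐ (Site d → S) :=
  MeasurableEquiv.arrowCongr' (Site.shift v) (MeasurableEquiv.refl S)

/-- `configShift v σ = σ ∘ (Site.shift v)⁻¹` (Georgii 2011, Ch. 5, (5.3)). [cite: Georgii2011, Ch. 5  (5.3] -/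
theorem configShift_eq_comp_symm (v : Site d) (σ : Site d → S) :
    configShift v σ = σ ∘ (Site.shift v).symm := rfl

/-- `configShift v σ x = σ (x - v)` (Georgii 2011, Ch. 5, (5.3)). [cite: Georgii2011, Ch. 5  (5.3] -/
@[simp] theorem configShift_apply (v : Site d) (σ : Site d → S) (x : Site d) :
    configShift v σ x = σ (x - v) := by
  simp [configShift_eq_comp_symm]

/-- `μ` is translation invariant: `μ ∘ θ_v⁻¹ = μ` for all `v ∈ ℤ^d`. Since `configShift v` is a
measurable equivalence, `Measure.map` carries no junk here (Georgii 2011, Ch. 5, Def. (5.4)). [cite: Georgii2011, Ch. 5  Def. (5.4] -/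
def IsTranslationInvariantMeasure (μ : Measure (Site d → S)) : Prop :=
  ∀ v : Site d, μ.map (configShift v) = μ

end Shift

/-! ### Interaction potentials and Gibbsian specifications -/

/-- An interaction potential `Φ = (Φ_A)_{A ⋐ V}`: for each finite `A`, a real function of the
configuration (Georgii 2011, Def. 2.7; Friedli–Velenik 2017, §6.3.2). [cite: Georgii2011, Def. 2.7] -/
abbrev Potential (V S : Type*) : Type _ := Finset V → (V → S) → ℝ

/-- `Φ` is adapted: each `Φ_A` depends only on the spins in `A` (Mathlib `DependsOn`) and is
measurable for the product σ-algebra. Georgii asks for `𝓕_A`-measurability of `Φ_A`, which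
implies both conjuncts (and is equivalent to them for countably generated standard Borel `S`);
for discrete `S` such as `ℤˣ` and countable `V` the measurability conjunct is automatic
(Georgii 2011, Def. 2.7 (i); Friedli–Velenik 2017, §6.3.2). [cite: Georgii2011, Def. 2.7 (i] -/
def Potential.IsAdapted (Φ : Potential V S) : Prop :=
  ∀ A : Finset V, DependsOn (Φ A) (↑A : Set V) ∧ Measurable (Φ A)

/-- `Φ` is supported by the volume-dependent finite families `supp`: for every finite volume
`Λ`, every interaction set `A` meeting `Λ` with `Φ_A ≠ 0` belongs to the finite family `supp Λ`
(so each finite volume interacts through finitely many sets only, as for finite-range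
potentials). Then the Hamiltonian `hamiltonianIn Φ supp Λ` is Georgii's full `H_Λ^Φ`
(Georgii 2011, (2.11) and Ex. 2.12; Friedli–Velenik 2017, §6.3.2, range of a potential). [cite: Georgii2011, (2.11] -/
def Potential.IsSupportedBy [DecidableEq V] (Φ : Potential V S)
    (supp : Finset V → Finset (Finset V)) : Prop :=
  ∀ (Λ A : Finset V), (A ∩ Λ).Nonempty → Φ A ≠ 0 → A ∈ supp Λ

/-- The Hamiltonian in the volume `Λ` of the potential `Φ`, summed over the volume-dependent
finite family `supp Λ` of interaction sets meeting `Λ`: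
`H_Λ^Φ(σ) = ∑_{A ∈ supp Λ, A ∩ Λ ≠ ∅} Φ_A(σ)` (Georgii 2011, eq. (2.11); Friedli–Velenik 2017,
eq. (6.24)). When `Potential.IsSupportedBy Φ supp` (e.g. finite range) this is the full
Hamiltonian; absolutely summable infinite-range potentials are out of scope in v0. [cite: Georgii2011, eq. (2.11] -/
def hamiltonianIn [DecidableEq V] (Φ : Potential V S) (supp : Finset V → Finset (Finset V))
    (Λ : Finset V) (σ : V → S) : ℝ :=
  ∑ A ∈ supp Λ with (A ∩ Λ).Nonempty, Φ A σ

/-- Glue a finite configuration `ζ : Λ → S` inside `Λ` with `η` outside: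
`glueWith Λ ζ η x = ζ x` for `x ∈ Λ`, `= η x` otherwise (Georgii 2011, notation `ζ η_{Λᶜ}`,
§1.2; Friedli–Velenik 2017, §6.2). This is Mathlib's `Function.updateFinset η Λ ζ`
(`glueWith_eq_updateFinset`), stated with classical decidability of `x ∈ Λ` and the argument
order of the trunk so that `glue Λ τ (.fixed η) = glueWith Λ τ η` (`IsingModel.glue`) holds by
`rfl` (`glue_fixed`) and no `[DecidableEq V]` is needed by the consumers. [cite: Georgii2011, notation  ζ η_{Λᶜ}   §1.2] -/
def glueWith (Λ : Finset V) (ζ : Λ → S) (η : V → S) : V → S :=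
  open Classical in fun x => if hx : x ∈ Λ then ζ ⟨x, hx⟩ else η x

omit [MeasurableSpace S] in
/-- `glueWith` is Mathlib's `Function.updateFinset` (up to the decidability instance and
argument order) (Georgii 2011, §1.2, `ζ η_{Λᶜ}`). [cite: Georgii2011, §1.2   ζ η_{Λᶜ}] -/
theorem glueWith_eq_updateFinset [DecidableEq V] (Λ : Finset V) (ζ : Λ → S) (η : V → S) :
    glueWith Λ ζ η = Function.updateFinset η Λ ζ := by
  funext x
  simp only [glueWith, Function.updateFinset]
  congr

/-- The Ising gluing of `IsingModel` with a fixed boundary condition is `glueWith`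
(Friedli–Velenik 2017, §3.1 and §6.2). [cite: FriedliVelenik2017, §3.1 and §6.2] -/
@[simp] theorem glue_fixed (Λ : Finset V) (τ : Λ → ℤˣ) (η : SpinConfig V) :
    glue Λ τ (.fixed η) = glueWith Λ τ η := rfl

omit [MeasurableSpace S] in
/-- Inside `Λ` the glued configuration is `ζ` (Georgii 2011, §1.2). [cite: Georgii2011, §1.2] -/
@[simp] theorem glueWith_apply_mem (Λ : Finset V) (ζ : Λ → S) (η : V → S) {x : V}
    (hx : x ∈ Λ) : glueWith Λ ζ η x = ζ ⟨x, hx⟩ := by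
  simp [glueWith, hx]

omit [MeasurableSpace S] in
/-- Outside `Λ` the glued configuration is `η` (Georgii 2011, §1.2). [cite: Georgii2011, §1.2] -/
@[simp] theorem glueWith_apply_not_mem (Λ : Finset V) (ζ : Λ → S) (η : V → S) {x : V}
    (hx : x ∉ Λ) : glueWith Λ ζ η x = η x := by
  simp [glueWith, hx]

/-- `ζ ↦ glueWith Λ ζ η` is measurable for the product σ-algebras; this is Mathlib
`measurable_updateFinset` transported along `glueWith_eq_updateFinset` (Georgii 2011, §1.2). [cite: Georgii2011, §1.2] -/
@[fun_prop]
theorem measurable_glueWith (Λ : Finset V) (η : V → S) :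
    Measurable fun ζ : Λ → S => glueWith Λ ζ η := by
  classical
  simp only [glueWith_eq_updateFinset]
  exact measurable_updateFinset

/-- The Gibbsian specification of the potential `Φ` (volume-dependent interaction family
`supp`, cf. `Potential.IsSupportedBy`) at inverse temperature `β` with a priori measure `ν` on
`S`: `γ_Λ(· | η) = (ν^{⊗Λ} ∘ glueWith⁻¹) tilted by exp (-β H_Λ^Φ)`, i.e.
`γ_Λ(dσ | η) = Z_Λ(η)⁻¹ e^{-β H_Λ(σ)} (ν^Λ ⊗ δ_{η_{Λᶜ}})(dσ)` (Georgii 2011, Def. 2.9;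
Friedli–Velenik 2017, eq. (6.29)). Built with Mathlib `Measure.tilted`, which returns the junk
value `0` when the normaliser `∫ exp (-β H_Λ)` is `0` or `∞` (e.g. `ν = 0`, or unbounded /
non-measurable `Φ`); `isProbabilityMeasure_gibbsSpecOfPotential` gives sufficient conditions
under which this does not happen. [cite: Georgii2011, Def. 2.9] -/
def gibbsSpecOfPotential [DecidableEq V] (ν : Measure S) (Φ : Potential V S)
    (supp : Finset V → Finset (Finset V)) (β : ℝ) : Specification V S :=
  fun Λ η => ((Measure.pi fun _ : Λ => ν).map (glueWith Λ · η)).tilted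
    fun σ => -β * hamiltonianIn Φ supp Λ σ

/-- For a nonzero finite a priori measure and a potential with measurable, bounded interaction
terms, the finite-volume Gibbs distribution `gibbsSpecOfPotential ν Φ supp β Λ η` is a
probability measure (the normaliser is finite and positive, so the `Measure.tilted` junk value is
not hit) (Georgii 2011, Def. 2.9 with (2.9); Friedli–Velenik 2017, Lemma 6.20). [cite: Georgii2011, Def. 2.9 with (2.9] -/
def isProbabilityMeasure_gibbsSpecOfPotential : Prop :=
  ∀ [DecidableEq V] (ν : Measure S) [IsFiniteMeasure ν] (hν : ν ≠ 0) {Φ : Potential V S} (hΦ : ∀ A, Measurable (Φ A)) (hΦb : ∀ A, ∃ C, ∀ σ, |Φ A σ| ≤ C) (supp : Finset V → Finset (Finset V)) (β : ℝ) (Λ : Finset V) (η : V → S),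
    IsProbabilityMeasure (gibbsSpecOfPotential ν Φ supp β Λ η)

/-! ### The Ising specification -/

section Ising

variable (G : SimpleGraph V) [DecidableEq V] [G.LocallyFinite]

/-- The Ising specification of the graph `G` at inverse temperature `β` and field `h`:
`γ_Λ(· | η) = μ_{Λ;β,h}^η`, the finite-volume Ising measure with boundary condition fixed to `η`
(Friedli–Velenik 2017, §6.2.1, eq. (6.6); Georgii 2011, Ex. 2.12). [cite: FriedliVelenik2017, §6.2.1  eq. (6.6] -/
def isingSpecification (β h : ℝ) : Specification V ℤˣ :=
  fun Λ η => isingMeasure G Λ β h (.fixed η)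

/-- `isingSpecification G β h Λ η` is the fixed-boundary Ising measure
(Friedli–Velenik 2017, §6.2.1). [cite: FriedliVelenik2017, §6.2.1] -/
@[simp] theorem isingSpecification_apply (β h : ℝ) (Λ : Finset V) (η : SpinConfig V) :
    isingSpecification G β h Λ η = isingMeasure G Λ β h (.fixed η) := rfl

/-- The Ising kernels form a specification: probability, `𝓕_{Λᶜ}`-measurability in the boundary
condition, properness and consistency (Friedli–Velenik 2017, Lemma 6.7 and Thm. 6.8;
Georgii 2011, Ex. 2.12 with Prop. 2.5). The site set is assumed **countable** (Georgii's
standing assumption; `Site d` is countable): for uncountable `V` the a.e. properness axiom of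
`IsSpecification` fails for every probability kernel (see `IsSpecification.proper`), so the
statement would be false. No sign condition on `β` is needed (unlike the outline's `0 ≤ β`):
`isingMeasure` is a probability measure for every real `β` and Georgii's Prop. 2.5 uses no sign,
so do not "fix" this statement by adding `0 ≤ β`. [cite: FriedliVelenik2017, Lemma 6.7 and Thm. 6.8] -/
def isSpecification_isingSpecification : Prop :=
  ∀ [Countable V] (β h : ℝ),
    IsSpecification (isingSpecification G β h)

end Ising

/-- The set of infinite-volume Ising Gibbs measures on `ℤ^d` at `(β, h)`:
`𝒢(β, h) = 𝒢(γ^{Ising}_{ℤ^d, β, h})` (Friedli–Velenik 2017, Def. 6.13 and §3.4;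
Georgii 2011, §6.2). [cite: FriedliVelenik2017, Def. 6.13 and §3.4] -/
def isingGibbsMeasures (d : ℕ) (β h : ℝ) : Set (Measure (SpinConfig (Site d))) :=
  gibbsMeasures (isingSpecification (zdGraph d) β h)

/-- Membership in `isingGibbsMeasures` is the DLR condition for the Ising specification on `ℤ^d`
(Friedli–Velenik 2017, Def. 6.13). [cite: FriedliVelenik2017, Def. 6.13] -/
@[simp] theorem mem_isingGibbsMeasures_iff (d : ℕ) (β h : ℝ) (μ : Measure (SpinConfig (Site d))) :
    μ ∈ isingGibbsMeasures d β h ↔ IsGibbsMeasure (isingSpecification (zdGraph d) β h) μ :=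
  Iff.rfl

/-- The Ising kernels on `ℤ^d` form a specification (`Site d` is countable, so
`isSpecification_isingSpecification` applies) (Friedli–Velenik 2017, Lemma 6.7, Thm. 6.8). [cite: FriedliVelenik2017, Lemma 6.7  Thm. 6.8] -/
def isSpecification_isingSpecification_zd : Prop :=
  ∀ (d : ℕ) (β h : ℝ),
    IsSpecification (isingSpecification (zdGraph d) β h)

/- interim proof relied on results that are now named facts (D-0014); demoted to a fact by the M5 import, proof preserved:
:=
  isSpecification_isingSpecification (zdGraph d) β h
-/

end Literature.Probability.LatticeModels
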